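import Mathlib
import Literature.Analysis.PDE.ConservationLawLipschitzTest

/-!
# Calculus of classical (locally Lipschitz) solutions of conservation laws

Sibling proof file of `ConservationLawWeakStrong.lean` (Dafermos, *Hyperbolic Conservation Laws in
Continuum Physics*, 1st ed. 2000 [Dafermos2000], §4.1 p. 110 and the proof of Thm 5.2.1, PDF
pp. 126–127 of the held scan), second layer of the proof of
`dafermos_weak_strong_uniqueness`.

Dafermos uses two facts about a classical solution `Ū` (bounded, locally Lipschitz, satisfying the
system a.e.): "Any weak solution which is locally Lipschitz is necessarily a classical solution"
(§4.1, p. 110) and "`Ū`, being a classical solution, will identically satisfy (4.3.4) as an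
equality" (p. 127).  For the vendored `IsClassicalSolution` (= locally Lipschitz weak solution) both
have to be proved; this file provides the integration-by-parts layer for an uncurried scalar
function `F : ℝ × ℝ^m → ℝ` Lipschitz on `[0,T'] × B̄(0,R)`:

* `time_slice_ibp` — one-dimensional integration by parts in time with the boundary term at
  `t = 0`, for a slice Lipschitz on `[0,T']` (clamped extension + Mathlib's
  `LipschitzWith.integral_lineDeriv_mul_eq`);
* `slab_ibp_time`, `slab_ibp_space` — integration by parts on the slab `(0,T) × ℝ^m` of a `C¹`
  compactly supported weight against `F`, the derivative of `F` being its a.e. Fréchet derivative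
  (Rademacher); the time version carries the boundary term `∫ θ(0,x) F(0,x) dx` (slice-wise
  integration by parts, McShane extension in space, Fubini);
* `ae_differentiableAt_of_lipschitzOn_boxes` — Rademacher on the slab for a field Lipschitz on the
  boxes `[0,T'] × B̄(0,R)`, `T' < T`;
* `ae_pde_of_lipschitz_weak` — such a field `V` (values in a compact convex `D ⊆ O`) satisfying the
  weak identity (4.1.6) for smooth test functions supported in the open slab satisfies the system
  a.e.: `DV·e₀ + ∑_α DG_α(V) DV·(0,e_α) = 0` (integration by parts + the fundamental lemma of the
  calculus of variations `IsOpen.ae_eq_zero_of_integral_contDiff_smul_eq_zero`);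
* `entropy_equality_of_lipschitz` — and then, given an entropy–entropy-flux pair with
  `Dq_α = Dη DG_α` (Dafermos (4.3.1)), satisfies the entropy identity
  `∫_slab [∂ₜθ η(V) + ∑ ∂_αθ q_α(V)] = -∫ θ(0,x) η(V(0,x)) dx` for every `θ ∈ C¹_c` vanishing for
  `t ≥ T' < T` (chain rule a.e.).

No new definitions of notions; no named facts.
-/

noncomputable section

open MeasureTheory Set Filter Topology Metric Function
open scoped BigOperators NNReal ContDiff

namespace Literature.Analysis.PDE

namespace ConservationLaw

variable {m n : ℕ}

/-! ### One-dimensional and slice helpers -/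

/-- On `ℝ`, the line derivative in the direction `1` is the usual derivative. [folklore] -/
theorem lineDeriv_one_eq_deriv (k : ℝ → ℝ) (t : ℝ) : lineDeriv ℝ k t 1 = deriv k t := by
  unfold lineDeriv
  simp only [smul_eq_mul, mul_one]
  rw [deriv_comp_const_add, add_zero]

/-- The slice `s ↦ θ(s,x)` of a function differentiable at `(t,x)` has derivative `Dθ(t,x)·(1,0)`
at `t`. [folklore] -/
theorem hasDerivAt_slice_time {F' : Type*} [NormedAddCommGroup F'] [NormedSpace ℝ F']
    {θ : ℝ × EuclideanSpace ℝ (Fin m) → F'} {t : ℝ}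
    {x : EuclideanSpace ℝ (Fin m)} (hθ : DifferentiableAt ℝ θ (t, x)) :
    HasDerivAt (fun s : ℝ => θ (s, x)) (fderiv ℝ θ (t, x) (dirT m)) t := by
  have h1 : HasDerivAt (fun s : ℝ => ((s, x) : ℝ × EuclideanSpace ℝ (Fin m))) (dirT m) t := by
    simpa [dirT] using (hasDerivAt_id t).prodMk (hasDerivAt_const t x)
  exact hθ.hasFDerivAt.comp_hasDerivAt t h1

/-- The line derivative of the space slice `y ↦ F(t,y)` in the direction `e` is the space–time line
derivative in the direction `(0,e)`. [folklore] -/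
theorem lineDeriv_slice_space {F' : Type*} [NormedAddCommGroup F'] [NormedSpace ℝ F']
    (F : ℝ × EuclideanSpace ℝ (Fin m) → F') (t : ℝ) (x e : EuclideanSpace ℝ (Fin m)) :
    lineDeriv ℝ (fun y => F (t, y)) x e = lineDeriv ℝ F (t, x) (0, e) := by
  unfold lineDeriv
  congr 1; ext s; simp

/-- A function vanishing on a neighbourhood of a point has zero line derivatives there.
[folklore] -/
theorem lineDeriv_eq_zero_of_notMem_tsupport {E' F' : Type*} [NormedAddCommGroup E']
    [NormedSpace ℝ E'] [NormedAddCommGroup F'] [NormedSpace ℝ F'] {f : E' → F'} {p : E'}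
    (hp : p ∉ tsupport f) (v : E') : lineDeriv ℝ f p v = 0 := by
  have : f =ᶠ[𝓝 p] 0 := notMem_tsupport_iff_eventuallyEq.1 hp
  rw [Filter.EventuallyEq.lineDeriv_eq this]
  unfold lineDeriv; simp

/-- For a `C¹` function the line derivative is continuous in the base point. [folklore] -/
theorem continuous_lineDeriv_of_contDiff {E' : Type*} [NormedAddCommGroup E'] [NormedSpace ℝ E']
    {θ : E' → ℝ} (hθ : ContDiff ℝ 1 θ) (v : E') : Continuous fun p => lineDeriv ℝ θ p v := by
  have : (fun p => lineDeriv ℝ θ p v) = fun p => fderiv ℝ θ p v := by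
    ext p; exact (hθ.differentiable one_ne_zero p).lineDeriv_eq_fderiv
  rw [this]; exact (hθ.continuous_fderiv one_ne_zero).clm_apply continuous_const

/-- Line derivatives of a `C¹` compactly supported function have compact support. [folklore] -/
theorem hasCompactSupport_lineDeriv_of_contDiff {E' : Type*} [NormedAddCommGroup E']
    [NormedSpace ℝ E'] {θ : E' → ℝ} (hθ : ContDiff ℝ 1 θ) (hθc : HasCompactSupport θ) (v : E') :
    HasCompactSupport fun p => lineDeriv ℝ θ p v := by
  have : (fun p => lineDeriv ℝ θ p v) = fun p => fderiv ℝ θ p v := by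
    ext p; exact (hθ.differentiable one_ne_zero p).lineDeriv_eq_fderiv
  rw [this]; exact hθc.fderiv_apply (𝕜 := ℝ) v

/-! ### Integrability helpers -/

/-- A bounded a.e.-strongly-measurable function on the slab vanishing off a compact set is integrable
on the slab. [folklore] -/
theorem integrableOn_slab_of_bdd {T : ℝ} {g : ℝ × EuclideanSpace ℝ (Fin m) → ℝ}
    (hg : AEStronglyMeasurable g (volume.restrict (slab m T)))
    {K : Set (ℝ × EuclideanSpace ℝ (Fin m))} (hK : IsCompact K) (hsupp : ∀ p ∉ K, g p = 0)
    {M : ℝ} (hM : ∀ p ∈ slab m T, ‖g p‖ ≤ M) : IntegrableOn g (slab m T) := by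
  have h1 : IntegrableOn g K (volume.restrict (slab m T)) := by
    refine Measure.integrableOn_of_bounded (M := M)
      ((Measure.restrict_apply_le _ _).trans_lt hK.measure_lt_top).ne hg ?_
    rw [Measure.restrict_restrict hK.measurableSet,
      ae_restrict_iff' (hK.measurableSet.inter (measurableSet_slab T))]
    exact Eventually.of_forall fun p hp => hM p hp.2
  rw [IntegrableOn, Measure.restrict_restrict hK.measurableSet] at h1
  exact IntegrableOn.of_forall_sdiff_eq_zero h1 (measurableSet_slab T) fun p hp =>
    hsupp p fun h => hp.2 ⟨h, hp.1⟩

/-- A continuous weight vanishing off a compact set times a function that is a.e.-strongly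
measurable on the slab and bounded where the weight is nonzero is integrable on the slab.
[folklore] -/
theorem integrableOn_slab_weight_mul {T : ℝ} {c F : ℝ × EuclideanSpace ℝ (Fin m) → ℝ}
    {S : Set (ℝ × EuclideanSpace ℝ (Fin m))} (hS : IsCompact S)
    (hc : Continuous c) (hc0 : ∀ p ∉ S, c p = 0)
    (hFm : AEStronglyMeasurable F (volume.restrict (slab m T)))
    {B : ℝ} (hB : ∀ p ∈ slab m T, c p ≠ 0 → ‖F p‖ ≤ B) :
    IntegrableOn (fun p => c p * F p) (slab m T) := by
  obtain ⟨Cc, hCc⟩ := (HasCompactSupport.intro hS hc0).exists_bound_of_continuous hc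
  refine integrableOn_slab_of_bdd (hc.aestronglyMeasurable.mul hFm) hS
    (fun p hp => by simp [hc0 p hp]) (M := max (Cc * B) 0) fun p hp => ?_
  by_cases hcp : c p = 0
  · simp [hcp]
  · calc ‖c p * F p‖ = ‖c p‖ * ‖F p‖ := norm_mul _ _
      _ ≤ Cc * B := mul_le_mul (hCc p) (hB p hp hcp) (norm_nonneg _) ((norm_nonneg _).trans (hCc p))
      _ ≤ max (Cc * B) 0 := le_max_left _ _

/-- Space version: a continuous weight vanishing off a compact set times an a.e.-strongly-measurable
function bounded where the weight is nonzero is integrable on `ℝ^m`. [folklore] -/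
theorem integrable_weight_mul {c g : EuclideanSpace ℝ (Fin m) → ℝ}
    {S : Set (EuclideanSpace ℝ (Fin m))} (hS : IsCompact S)
    (hc : Continuous c) (hc0 : ∀ x ∉ S, c x = 0) (hg : AEStronglyMeasurable g volume)
    {B : ℝ} (hB : ∀ x, c x ≠ 0 → ‖g x‖ ≤ B) : Integrable (fun x => c x * g x) := by
  obtain ⟨Cc, hCc⟩ := (HasCompactSupport.intro hS hc0).exists_bound_of_continuous hc
  have h1 : IntegrableOn (fun x => c x * g x) S := by
    refine Measure.integrableOn_of_bounded (M := max (Cc * B) 0) hS.measure_lt_top.ne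
      (hc.aestronglyMeasurable.mul hg) (Eventually.of_forall fun x => ?_)
    by_cases hcx : c x = 0
    · simp [hcx]
    · calc ‖c x * g x‖ = ‖c x‖ * ‖g x‖ := norm_mul _ _
        _ ≤ Cc * B := mul_le_mul (hCc x) (hB x hcx) (norm_nonneg _) ((norm_nonneg _).trans (hCc x))
        _ ≤ max (Cc * B) 0 := le_max_left _ _
  exact (integrableOn_iff_integrable_of_support_subset (fun x hx => by
    by_contra h; exact hx (by simp [hc0 x h]))).1 h1

/-! ### One-dimensional integration by parts in time with boundary term -/

/-- **Time slice integration by parts.**  For `θ ∈ C¹_c(ℝ × ℝ^m)` vanishing for `t ≥ T'`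
(`0 < T' < T`) and a slice `s ↦ F(s,x)` Lipschitz on `[0,T']`,
`∫_{(0,T)} ∂ₜθ(s,x) F(s,x) ds = -θ(0,x)F(0,x) - ∫_{(0,T)} θ(s,x) ∂ₛF(s,x) ds`
(clamped Lipschitz extension of the slice to `ℝ` and `LipschitzWith.integral_lineDeriv_mul_eq`).
[folklore] -/
theorem time_slice_ibp {F θ : ℝ × EuclideanSpace ℝ (Fin m) → ℝ} {T T' : ℝ} {Lx : ℝ≥0}
    (hT'0 : 0 < T') (hT'T : T' < T) (hθ : ContDiff ℝ 1 θ) (hθc : HasCompactSupport θ)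
    (hθT : ∀ p : ℝ × EuclideanSpace ℝ (Fin m), T' ≤ p.1 → θ p = 0)
    {x : EuclideanSpace ℝ (Fin m)}
    (hFx : LipschitzOnWith Lx (fun s : ℝ => F (s, x)) (Set.Icc 0 T')) :
    ∫ s in Set.Ioo 0 T, lineDeriv ℝ θ (s, x) (dirT m) * F (s, x)
      = -(θ (0, x) * F (0, x)) - ∫ s in Set.Ioo 0 T, θ (s, x) * deriv (fun r => F (r, x)) s := by
  -- the clamped slice
  set clamp : ℝ → ℝ := fun s => max 0 (min T' s) with hclamp
  have hclamp_mem : ∀ s, clamp s ∈ Set.Icc 0 T' := fun s =>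
    ⟨le_max_left _ _, max_le hT'0.le (min_le_left _ _)⟩
  have hclamp_lip : LipschitzWith 1 clamp := (LipschitzWith.id.const_min T').const_max 0
  have hclamp_neg : ∀ s, s < 0 → clamp s = 0 := fun s hs => by
    simp only [hclamp]; rw [max_eq_left]; exact (min_le_right _ _).trans hs.le
  have hclamp_mid : ∀ s ∈ Set.Icc 0 T', clamp s = s := fun s hs => by
    simp only [hclamp]; rw [min_eq_right hs.2, max_eq_right hs.1]
  set k : ℝ → ℝ := fun s => F (clamp s, x) with hk
  have hk_lip : LipschitzWith Lx k := by
    refine LipschitzWith.of_dist_le_mul fun s s' => ?_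
    calc dist (k s) (k s') ≤ Lx * dist (clamp s) (clamp s') :=
          hFx.dist_le_mul _ (hclamp_mem s) _ (hclamp_mem s')
      _ ≤ Lx * dist s s' := by
          refine mul_le_mul_of_nonneg_left ?_ (by positivity)
          simpa using hclamp_lip.dist_le_mul s s'
  have hk_cont : Continuous k := hk_lip.continuous
  -- the slice of `θ` and its support
  set θx : ℝ → ℝ := fun s => θ (s, x) with hθx
  have hθx_c1 : ContDiff ℝ 1 θx := hθ.comp (contDiff_id.prodMk contDiff_const)
  obtain ⟨ρ, hρ0, hρ⟩ := hθc.isCompact.isBounded.subset_closedBall_lt 0 0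
  have hnotsupp : ∀ s, ρ < |s| → (s, x) ∉ tsupport θ := fun s hs h => by
    have h1 := mem_closedBall_zero_iff.1 (hρ h)
    have h2 : |s| ≤ ‖((s, x) : ℝ × EuclideanSpace ℝ (Fin m))‖ :=
      (Real.norm_eq_abs s) ▸ norm_fst_le ((s, x) : ℝ × EuclideanSpace ℝ (Fin m))
    linarith
  have hθx_zero : ∀ s, ρ < |s| → θx s = 0 := fun s hs =>
    show θ (s, x) = 0 from image_eq_zero_of_notMem_tsupport (hnotsupp s hs)
  have hθx_supp : HasCompactSupport θx := by
    refine HasCompactSupport.intro (isCompact_Icc (a := -ρ) (b := ρ)) fun s hs => hθx_zero s ?_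
    by_contra h
    push Not at h
    exact hs (abs_le.1 h |> fun h' => ⟨by linarith [h'.1], h'.2⟩)
  obtain ⟨D, hθx_lip⟩ := hθx_c1.lipschitzWith_of_hasCompactSupport hθx_supp one_ne_zero
  have hθx_deriv : ∀ s, deriv θx s = lineDeriv ℝ θ (s, x) (dirT m) := fun s =>
    testTimeDeriv_eq_lineDeriv θ s x
  -- `∂ₜθ(s,x)` vanishes for `s > T'`, `θ(s,x)` for `s ≥ T'`
  have hθ1 : ∀ s, T' ≤ s → θ (s, x) = 0 := fun s hs => hθT (s, x) hs
  have hθ2 : ∀ s, T' < s → lineDeriv ℝ θ (s, x) (dirT m) = 0 := by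
    intro s hs
    refine lineDeriv_eq_zero_of_notMem_tsupport ?_ _
    rw [notMem_tsupport_iff_eventuallyEq]
    filter_upwards [(isOpen_lt continuous_const continuous_fst).mem_nhds hs] with q hq
    exact hθT q (le_of_lt hq)
  -- the slice `∂ₜθ(·,x)` is continuous with compact support
  have hθt_cont : Continuous fun s => lineDeriv ℝ θ (s, x) (dirT m) :=
    (continuous_lineDeriv_of_contDiff hθ _).comp (continuous_id.prodMk continuous_const)
  have hθt_zero : ∀ s, ρ < |s| → lineDeriv ℝ θ (s, x) (dirT m) = 0 := fun s hs =>
    lineDeriv_eq_zero_of_notMem_tsupport (hnotsupp s hs) _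
  have hθt_supp : HasCompactSupport fun s => lineDeriv ℝ θ (s, x) (dirT m) := by
    refine HasCompactSupport.intro (isCompact_Icc (a := -ρ) (b := ρ)) fun s hs => hθt_zero s ?_
    by_contra h
    push Not at h
    exact hs (abs_le.1 h |> fun h' => ⟨by linarith [h'.1], h'.2⟩)
  -- facts about `k`
  have hk1 : ∀ s, s < 0 → k s = F (0, x) := fun s hs => by simp only [hk, hclamp_neg s hs]
  have hk2 : ∀ s ∈ Set.Icc 0 T', k s = F (s, x) := fun s hs => by simp only [hk, hclamp_mid s hs]
  have hk3 : ∀ s, s < 0 → deriv k s = 0 := by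
    intro s hs
    have : k =ᶠ[𝓝 s] fun _ => F (0, x) := by
      filter_upwards [(isOpen_gt' (0 : ℝ)).mem_nhds hs] with r hr
      exact hk1 r hr
    rw [this.deriv_eq]; exact deriv_const s _
  have hk4 : ∀ s ∈ Set.Ioo 0 T', deriv k s = deriv (fun r => F (r, x)) s := by
    intro s hs
    have : k =ᶠ[𝓝 s] fun r => F (r, x) := by
      filter_upwards [isOpen_Ioo.mem_nhds hs] with r hr
      exact hk2 r (Set.Ioo_subset_Icc_self hr)
    rw [this.deriv_eq]
  -- integration by parts on the line
  have ibp := LipschitzWith.integral_lineDeriv_mul_eq (μ := volume) hk_lip hθx_lip hθx_supp 1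
  simp_rw [lineDeriv_neg, lineDeriv_one_eq_deriv] at ibp
  -- `ibp : ∫ s, deriv k s * θx s = ∫ s, -deriv θx s * k s`
  have hae0 : ∀ᵐ s ∂(volume : Measure ℝ), s ≠ 0 := by
    simp [ae_iff, measure_singleton]
  -- left-hand side
  have hL : ∫ s, deriv k s * θx s
      = ∫ s in Set.Ioo 0 T, θ (s, x) * deriv (fun r => F (r, x)) s := by
    rw [← integral_indicator measurableSet_Ioo]
    refine integral_congr_ae ?_
    filter_upwards [hae0] with s hs0
    rcases lt_or_gt_of_ne hs0 with hs | hs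
    · rw [indicator_of_notMem (fun h => absurd h.1 (not_lt.2 hs.le)), hk3 s hs, zero_mul]
    · by_cases hsT' : s < T'
      · rw [indicator_of_mem (show s ∈ Set.Ioo 0 T from ⟨hs, hsT'.trans hT'T⟩),
          hk4 s ⟨hs, hsT'⟩, mul_comm]
      · push Not at hsT'
        have h0 : θ (s, x) = 0 := hθ1 s hsT'
        have h1 : (Set.Ioo 0 T).indicator (fun s => θ (s, x) * deriv (fun r => F (r, x)) s) s
            = 0 := by
          rw [Set.indicator_apply_eq_zero]; intro; rw [h0, zero_mul]
        rw [h1]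
        show deriv k s * θ (s, x) = 0
        rw [h0, mul_zero]
  -- right-hand side
  have hint : Integrable (fun s => lineDeriv ℝ θ (s, x) (dirT m) * k s) :=
    (hθt_cont.mul hk_cont).integrable_of_hasCompactSupport hθt_supp.mul_right
  have p1 : ∫ s in Set.Iio 0, lineDeriv ℝ θ (s, x) (dirT m) * k s = θ (0, x) * F (0, x) := by
    have e : ∫ s in Set.Iio 0, lineDeriv ℝ θ (s, x) (dirT m) * k s
        = ∫ s in Set.Iio 0, deriv θx s * F (0, x) :=
      setIntegral_congr_fun measurableSet_Iio fun s hs => by rw [hk1 s hs, hθx_deriv]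
    rw [e, integral_mul_const, ← integral_Iic_eq_integral_Iio]
    have hFTC : ∫ s in Set.Iic 0, deriv θx s = θx 0 - 0 := by
      refine integral_Iic_of_hasDerivAt_of_tendsto hθx_c1.continuous.continuousWithinAt
        (fun s _ => ((hθx_c1.differentiable one_ne_zero) s).hasDerivAt)
        ((hθx_c1.continuous_deriv le_rfl).integrable_of_hasCompactSupport
          hθx_supp.deriv).integrableOn ?_
      refine tendsto_const_nhds.congr' ?_
      rw [Filter.EventuallyEq, Filter.eventually_atBot]
      exact ⟨-ρ - 1, fun s hs => (hθx_zero s (by rw [abs_of_neg (by linarith)]; linarith)).symm⟩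
    rw [hFTC, sub_zero]
  have p2 : ∫ s in (Set.Iio 0)ᶜ, lineDeriv ℝ θ (s, x) (dirT m) * k s
      = ∫ s in Set.Ioo 0 T, lineDeriv ℝ θ (s, x) (dirT m) * F (s, x) := by
    rw [Set.compl_Iio, integral_Ici_eq_integral_Ioi]
    have e : ∫ s in Set.Ioi (0 : ℝ), lineDeriv ℝ θ (s, x) (dirT m) * k s
        = ∫ s in Set.Ioi (0 : ℝ), (Set.Ioo 0 T).indicator
            (fun s => lineDeriv ℝ θ (s, x) (dirT m) * F (s, x)) s := by
      refine setIntegral_congr_fun measurableSet_Ioi fun s (hs : 0 < s) => ?_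
      by_cases hsT : s < T
      · rw [indicator_of_mem (show s ∈ Set.Ioo 0 T from ⟨hs, hsT⟩)]
        by_cases hsT' : s ≤ T'
        · rw [hk2 s ⟨hs.le, hsT'⟩]
        · push Not at hsT'
          rw [hθ2 s hsT', zero_mul, zero_mul]
      · rw [indicator_of_notMem (fun h => hsT h.2)]
        have : T' < s := hT'T.trans_le (not_lt.1 hsT)
        rw [hθ2 s this, zero_mul]
    rw [e, setIntegral_indicator measurableSet_Ioo, Set.inter_eq_right.2 Set.Ioo_subset_Ioi_self]
  have hR : ∫ s, -deriv θx s * k s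
      = -(θ (0, x) * F (0, x)) - ∫ s in Set.Ioo 0 T, lineDeriv ℝ θ (s, x) (dirT m) * F (s, x) := by
    simp_rw [neg_mul, integral_neg, hθx_deriv]
    rw [← integral_add_compl (measurableSet_Iio (a := (0 : ℝ))) hint, p1, p2]
    ring
  rw [hL, hR] at ibp
  linarith

/-! ### Integration by parts on the slab against a Lipschitz function -/

section slabIBP

variable {F θ : ℝ × EuclideanSpace ℝ (Fin m) → ℝ} {T T' R : ℝ} {L : ℝ≥0}

/-- Geometry of the support: if `θ = 0` for `t ≥ T'` and `tsupport θ ⊆ {|x| < R}`, then the points of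
`tsupport θ` with `t ≥ 0` lie in `[0,T'] × B̄(0,R)`. [folklore] -/
theorem tsupport_inter_subset_box (hθT : ∀ p : ℝ × EuclideanSpace ℝ (Fin m), T' ≤ p.1 → θ p = 0)
    (hθR : ∀ p ∈ tsupport θ, ‖p.2‖ < R) :
    tsupport θ ∩ {p | 0 ≤ p.1} ⊆ Set.Icc 0 T' ×ˢ closedBall (0 : EuclideanSpace ℝ (Fin m)) R := by
  rintro p ⟨hp1, hp2⟩
  refine ⟨⟨hp2, ?_⟩, mem_closedBall_zero_iff.2 (hθR p hp1).le⟩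
  by_contra h
  push Not at h
  have : p ∉ tsupport θ := by
    rw [notMem_tsupport_iff_eventuallyEq]
    filter_upwards [(isOpen_lt continuous_const continuous_fst).mem_nhds h] with q hq
    exact hθT q (le_of_lt hq)
  exact this hp1

/-- If `θ p ≠ 0` for a point of the slab then `[0,T'] × B̄(0,R)` is a neighbourhood of `p`.
[folklore] -/
theorem box_mem_nhds_of_ne_zero (hθT : ∀ p : ℝ × EuclideanSpace ℝ (Fin m), T' ≤ p.1 → θ p = 0)
    (hθR : ∀ p ∈ tsupport θ, ‖p.2‖ < R) {p : ℝ × EuclideanSpace ℝ (Fin m)} (hp : p ∈ slab m T)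
    (hθp : θ p ≠ 0) :
    Set.Icc 0 T' ×ˢ closedBall (0 : EuclideanSpace ℝ (Fin m)) R ∈ 𝓝 p := by
  have hp1 : p.1 < T' := lt_of_not_ge fun h => hθp (hθT p h)
  have hp2 : ‖p.2‖ < R := hθR p (subset_tsupport _ hθp)
  have hO : IsOpen (Set.Ioo 0 T' ×ˢ ball (0 : EuclideanSpace ℝ (Fin m)) R) :=
    isOpen_Ioo.prod isOpen_ball
  refine mem_of_superset (hO.mem_nhds ⟨⟨(mem_slab.1 hp).1, hp1⟩, mem_ball_zero_iff.2 hp2⟩) ?_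
  exact Set.prod_mono Set.Ioo_subset_Icc_self ball_subset_closedBall

/-- From a.e. differentiability on the slab to: for a.e. `x`, for a.e. `t ∈ (0,T)`,
differentiability at `(t,x)`. [folklore] -/
theorem ae_ae_time_of_ae_slab {P : ℝ × EuclideanSpace ℝ (Fin m) → Prop}
    (hPm : MeasurableSet {p | P p}) (hP : ∀ᵐ p ∂volume, p ∈ slab m T → P p) :
    ∀ᵐ x ∂(volume : Measure (EuclideanSpace ℝ (Fin m))),
      ∀ᵐ s ∂(volume.restrict (Set.Ioo 0 T)), P (s, x) := by
  have h1 : ∀ᵐ p ∂(volume.restrict (slab m T)), P p :=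
    (ae_restrict_iff' (measurableSet_slab T)).2 hP
  rw [volume_restrict_slab] at h1
  have h2 := Measure.ae_ae_of_ae_prod h1
  exact (Measure.ae_ae_comm (p := fun s x => P (s, x)) (by simpa using hPm)).1 h2

/-- From a.e. differentiability on the slab to: for a.e. `t ∈ (0,T)`, for a.e. `x`,
the property at `(t,x)`. [folklore] -/
theorem ae_ae_space_of_ae_slab {P : ℝ × EuclideanSpace ℝ (Fin m) → Prop}
    (hP : ∀ᵐ p ∂volume, p ∈ slab m T → P p) :
    ∀ᵐ s ∂(volume.restrict (Set.Ioo 0 T)),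
      ∀ᵐ x ∂(volume : Measure (EuclideanSpace ℝ (Fin m))), P (s, x) := by
  have h1 : ∀ᵐ p ∂(volume.restrict (slab m T)), P p :=
    (ae_restrict_iff' (measurableSet_slab T)).2 hP
  rw [volume_restrict_slab] at h1
  exact Measure.ae_ae_of_ae_prod h1

/-- Integrability on the slab of `∂_vθ · F` for `θ ∈ C¹_c` (vanishing for `t ≥ T'`, supported in
`|x| < R`) and `F` Lipschitz on `[0,T'] × B̄(0,R)`. [folklore] -/
theorem integrableOn_slab_lineDeriv_mul
    (hθ : ContDiff ℝ 1 θ) (hθc : HasCompactSupport θ)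
    (hθT : ∀ p : ℝ × EuclideanSpace ℝ (Fin m), T' ≤ p.1 → θ p = 0)
    (hθR : ∀ p ∈ tsupport θ, ‖p.2‖ < R)
    (hFm : AEStronglyMeasurable F (volume.restrict (slab m T)))
    (hFK : LipschitzOnWith L F (Set.Icc 0 T' ×ˢ closedBall 0 R)) (v : ℝ × EuclideanSpace ℝ (Fin m)) :
    IntegrableOn (fun p => lineDeriv ℝ θ p v * F p) (slab m T) := by
  obtain ⟨B, hB⟩ : ∃ B, ∀ p ∈ Set.Icc 0 T' ×ˢ closedBall (0 : EuclideanSpace ℝ (Fin m)) R, ‖F p‖ ≤ B :=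
    (isCompact_Icc.prod (isCompact_closedBall _ _)).exists_bound_of_continuousOn hFK.continuousOn
  refine integrableOn_slab_weight_mul hθc (continuous_lineDeriv_of_contDiff hθ _)
    (fun p hp => lineDeriv_eq_zero_of_notMem_tsupport hp _) hFm (B := B) fun p hp hne => hB p ?_
  have : p ∈ tsupport θ := by
    by_contra h; exact hne (lineDeriv_eq_zero_of_notMem_tsupport h _)
  exact tsupport_inter_subset_box hθT hθR ⟨this, (mem_slab.1 hp).1.le⟩

/-- Integrability on the slab of `θ · (DF·v)` for `θ ∈ C¹_c` (vanishing for `t ≥ T'`, supported in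
`|x| < R`) and `F` Lipschitz on `[0,T'] × B̄(0,R)` (the Fréchet derivative is bounded by the
Lipschitz constant where `θ ≠ 0`, and measurable by `measurable_fderiv_apply_const`). [folklore] -/
theorem integrableOn_slab_mul_fderiv
    (hθ : ContDiff ℝ 1 θ) (hθc : HasCompactSupport θ)
    (hθT : ∀ p : ℝ × EuclideanSpace ℝ (Fin m), T' ≤ p.1 → θ p = 0)
    (hθR : ∀ p ∈ tsupport θ, ‖p.2‖ < R)
    (hFK : LipschitzOnWith L F (Set.Icc 0 T' ×ˢ closedBall 0 R)) (v : ℝ × EuclideanSpace ℝ (Fin m)) :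
    IntegrableOn (fun p => θ p * fderiv ℝ F p v) (slab m T) := by
  refine integrableOn_slab_weight_mul hθc hθ.continuous
    (fun p hp => image_eq_zero_of_notMem_tsupport hp)
    ((measurable_fderiv_apply_const ℝ F v).aestronglyMeasurable) (B := L * ‖v‖)
    fun p hp hne => ?_
  calc ‖fderiv ℝ F p v‖ ≤ ‖fderiv ℝ F p‖ * ‖v‖ := ContinuousLinearMap.le_opNorm _ _
    _ ≤ L * ‖v‖ := by
      gcongr
      exact norm_fderiv_le_of_lipschitzOn ℝ (box_mem_nhds_of_ne_zero hθT hθR hp hne) hFK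

/-- **Time integration by parts on the slab against a Lipschitz function** (the step "`Ū`, being a
classical solution, will identically satisfy (4.3.4) as an equality" of Dafermos' proof, p. 127,
made quantitative): for `θ ∈ C¹_c` vanishing for `t ≥ T'` (`0 < T' < T`) and supported in
`|x| < R`, and `F` Lipschitz on `[0,T'] × B̄(0,R)`, Fréchet differentiable a.e. on the slab,
`∫_slab ∂ₜθ F = -∫ θ(0,x) F(0,x) dx - ∫_slab θ (DF·e₀)`. [folklore] -/
theorem slab_ibp_time (hT'0 : 0 < T') (hT'T : T' < T)
    (hθ : ContDiff ℝ 1 θ) (hθc : HasCompactSupport θ)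
    (hθT : ∀ p : ℝ × EuclideanSpace ℝ (Fin m), T' ≤ p.1 → θ p = 0)
    (hθR : ∀ p ∈ tsupport θ, ‖p.2‖ < R)
    (hFm : AEStronglyMeasurable F (volume.restrict (slab m T)))
    (hF0m : AEStronglyMeasurable (fun x => F (0, x)) volume)
    (hFK : LipschitzOnWith L F (Set.Icc 0 T' ×ˢ closedBall 0 R))
    (hFd : ∀ᵐ p ∂volume, p ∈ slab m T → DifferentiableAt ℝ F p) :
    ∫ p in slab m T, lineDeriv ℝ θ p (dirT m) * F p
      = -(∫ x, θ (0, x) * F (0, x)) - ∫ p in slab m T, θ p * fderiv ℝ F p (dirT m) := by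
  haveI := isAddHaarMeasure_volume_spaceTime (m := m)
  set K : Set (ℝ × EuclideanSpace ℝ (Fin m)) := Set.Icc 0 T' ×ˢ closedBall 0 R with hKdef
  have hKc : IsCompact K := isCompact_Icc.prod (isCompact_closedBall _ _)
  have hθt_cont : Continuous fun p => lineDeriv ℝ θ p (dirT m) :=
    continuous_lineDeriv_of_contDiff hθ _
  obtain ⟨B, hB⟩ : ∃ B, ∀ p ∈ K, ‖F p‖ ≤ B := hKc.exists_bound_of_continuousOn hFK.continuousOn
  have hsuppK := tsupport_inter_subset_box hθT hθR
  -- integrability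
  have hI1 : IntegrableOn (fun p => lineDeriv ℝ θ p (dirT m) * F p) (slab m T) :=
    integrableOn_slab_lineDeriv_mul hθ hθc hθT hθR hFm hFK _
  have hI2 : IntegrableOn (fun p => θ p * fderiv ℝ F p (dirT m)) (slab m T) :=
    integrableOn_slab_mul_fderiv hθ hθc hθT hθR hFK _
  have hI0 : Integrable (fun x => θ (0, x) * F (0, x)) := by
    obtain ⟨ρ, hρ⟩ := hθc.isCompact.isBounded.subset_closedBall 0
    refine integrable_weight_mul (isCompact_closedBall (0 : EuclideanSpace ℝ (Fin m)) ρ)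
      (hθ.continuous.comp (Continuous.prodMk_right 0)) (fun x hx => ?_) hF0m (B := B)
      fun x hx => hB _ (hsuppK ⟨subset_tsupport _ hx, (le_refl (0 : ℝ) : (0 : ℝ) ≤ 0)⟩)
    apply image_eq_zero_of_notMem_tsupport
    intro h; apply hx
    have := mem_closedBall_zero_iff.1 (hρ h)
    exact mem_closedBall_zero_iff.2 ((norm_snd_le ((0 : ℝ), x)).trans this)
  -- Fubini, `x` outer
  have hI1' : Integrable (fun p => lineDeriv ℝ θ p (dirT m) * F p)
      (((volume : Measure ℝ).restrict (Set.Ioo 0 T)).prod volume) := by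
    rw [← volume_restrict_slab]; exact hI1
  have hI2' : Integrable (fun p => θ p * fderiv ℝ F p (dirT m))
      (((volume : Measure ℝ).restrict (Set.Ioo 0 T)).prod volume) := by
    rw [← volume_restrict_slab]; exact hI2
  have e1 : ∫ p in slab m T, lineDeriv ℝ θ p (dirT m) * F p
      = ∫ x, ∫ s in Set.Ioo 0 T, lineDeriv ℝ θ (s, x) (dirT m) * F (s, x) := by
    rw [volume_restrict_slab]; exact integral_prod_symm _ hI1'
  have e2 : ∫ p in slab m T, θ p * fderiv ℝ F p (dirT m)
      = ∫ x, ∫ s in Set.Ioo 0 T, θ (s, x) * fderiv ℝ F (s, x) (dirT m) := by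
    rw [volume_restrict_slab]; exact integral_prod_symm _ hI2'
  -- per-`x` identity
  have e3 : ∀ x, ∫ s in Set.Ioo 0 T, lineDeriv ℝ θ (s, x) (dirT m) * F (s, x)
      = -(θ (0, x) * F (0, x)) - ∫ s in Set.Ioo 0 T, θ (s, x) * deriv (fun r => F (r, x)) s := by
    intro x
    by_cases hx : x ∈ closedBall (0 : EuclideanSpace ℝ (Fin m)) R
    · refine time_slice_ibp hT'0 hT'T hθ hθc hθT (Lx := L) ?_
      refine LipschitzOnWith.of_dist_le_mul fun s hs s' hs' => ?_
      have := hFK.dist_le_mul (s, x) ⟨hs, hx⟩ (s', x) ⟨hs', hx⟩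
      simpa [Prod.dist_eq] using this
    · have h0 : ∀ s, ((s, x) : ℝ × EuclideanSpace ℝ (Fin m)) ∉ tsupport θ := fun s h =>
        hx (mem_closedBall_zero_iff.2 (hθR (s, x) h).le)
      simp [image_eq_zero_of_notMem_tsupport (h0 _), lineDeriv_eq_zero_of_notMem_tsupport (h0 _)]
  -- a.e. in `x`: the slice derivative is the Fréchet derivative
  have e4 : ∀ᵐ x ∂(volume : Measure (EuclideanSpace ℝ (Fin m))),
      ∫ s in Set.Ioo 0 T, θ (s, x) * deriv (fun r => F (r, x)) s
        = ∫ s in Set.Ioo 0 T, θ (s, x) * fderiv ℝ F (s, x) (dirT m) := by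
    have h := ae_ae_time_of_ae_slab (measurableSet_of_differentiableAt ℝ F) hFd
    filter_upwards [h] with x hx
    refine integral_congr_ae ?_
    filter_upwards [hx] with s hs
    rw [(hasDerivAt_slice_time hs).deriv]
  -- assemble
  rw [e1, e2]
  calc ∫ x, ∫ s in Set.Ioo 0 T, lineDeriv ℝ θ (s, x) (dirT m) * F (s, x)
      = ∫ x, (-(θ (0, x) * F (0, x))
          - ∫ s in Set.Ioo 0 T, θ (s, x) * fderiv ℝ F (s, x) (dirT m)) := by
        refine integral_congr_ae ?_
        filter_upwards [e4] with x hx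
        rw [e3 x, hx]
    _ = (∫ x, -(θ (0, x) * F (0, x)))
          - ∫ x, ∫ s in Set.Ioo 0 T, θ (s, x) * fderiv ℝ F (s, x) (dirT m) :=
        integral_sub hI0.neg hI2'.integral_prod_right
    _ = _ := by rw [integral_neg]

/-- **Space integration by parts on the slab against a Lipschitz function**: for `θ ∈ C¹_c`
vanishing for `t ≥ T'` (`T' < T`) and supported in `|x| < R`, and `F` Lipschitz on
`[0,T'] × B̄(0,R)`, Fréchet differentiable a.e. on the slab,
`∫_slab ∂_αθ F = -∫_slab θ (DF·(0,e_α))` (McShane extension of the slices and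
`LipschitzWith.integral_lineDeriv_mul_eq` on `ℝ^m`). [folklore] -/
theorem slab_ibp_space
    (hθ : ContDiff ℝ 1 θ) (hθc : HasCompactSupport θ)
    (hθT : ∀ p : ℝ × EuclideanSpace ℝ (Fin m), T' ≤ p.1 → θ p = 0)
    (hθR : ∀ p ∈ tsupport θ, ‖p.2‖ < R)
    (hFm : AEStronglyMeasurable F (volume.restrict (slab m T)))
    (hFK : LipschitzOnWith L F (Set.Icc 0 T' ×ˢ closedBall 0 R))
    (hFd : ∀ᵐ p ∂volume, p ∈ slab m T → DifferentiableAt ℝ F p) (α : Fin m) :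
    ∫ p in slab m T, lineDeriv ℝ θ p (dirX α) * F p
      = -∫ p in slab m T, θ p * fderiv ℝ F p (dirX α) := by
  haveI := isAddHaarMeasure_volume_spaceTime (m := m)
  set K : Set (ℝ × EuclideanSpace ℝ (Fin m)) := Set.Icc 0 T' ×ˢ closedBall 0 R with hKdef
  have hKc : IsCompact K := isCompact_Icc.prod (isCompact_closedBall _ _)
  have hθa_cont : Continuous fun p => lineDeriv ℝ θ p (dirX α) :=
    continuous_lineDeriv_of_contDiff hθ _
  obtain ⟨B, hB⟩ : ∃ B, ∀ p ∈ K, ‖F p‖ ≤ B := hKc.exists_bound_of_continuousOn hFK.continuousOn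
  have hsuppK := tsupport_inter_subset_box hθT hθR
  -- integrability
  have hI1 : IntegrableOn (fun p => lineDeriv ℝ θ p (dirX α) * F p) (slab m T) :=
    integrableOn_slab_lineDeriv_mul hθ hθc hθT hθR hFm hFK _
  have hI2 : IntegrableOn (fun p => θ p * fderiv ℝ F p (dirX α)) (slab m T) :=
    integrableOn_slab_mul_fderiv hθ hθc hθT hθR hFK _
  -- per-`t` identity
  have e3 : ∀ s ∈ Set.Ioo 0 T, ∫ x, lineDeriv ℝ θ (s, x) (dirX α) * F (s, x)
      = -∫ x, θ (s, x) * lineDeriv ℝ (fun y => F (s, y)) x (EuclideanSpace.single α (1 : ℝ)) := by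
    intro s hs
    by_cases hsT' : T' ≤ s
    · -- `θ(s,·) ≡ 0` together with its derivatives
      have hz : (fun y => θ (s, y)) = fun _ => (0 : ℝ) := funext fun y => hθT (s, y) hsT'
      have h1 : ∀ x, lineDeriv ℝ θ (s, x) (dirX α) = 0 := fun x => by
        rw [show dirX α = ((0 : ℝ), EuclideanSpace.single α (1 : ℝ)) from rfl,
          ← lineDeriv_slice_space, hz]
        unfold lineDeriv; simp
      have h2 : ∀ x, θ (s, x) = 0 := fun x => hθT (s, x) hsT'
      simp [h1, h2]
    · push Not at hsT'
      -- McShane extension of the slice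
      have hslice : LipschitzOnWith L (fun y => F (s, y)) (closedBall 0 R) := by
        refine LipschitzOnWith.of_dist_le_mul fun y hy y' hy' => ?_
        have := hFK.dist_le_mul (s, y) ⟨⟨hs.1.le, hsT'.le⟩, hy⟩ (s, y') ⟨⟨hs.1.le, hsT'.le⟩, hy'⟩
        simpa [Prod.dist_eq] using this
      obtain ⟨g, hg_lip, hg_eq⟩ := hslice.extend_real
      -- the slice of `θ` and its support
      have hθs_c1 : ContDiff ℝ 1 fun y => θ (s, y) := hθ.comp (contDiff_const.prodMk contDiff_id)
      obtain ⟨ρ, hρ⟩ := hθc.isCompact.isBounded.subset_closedBall 0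
      have hnot : ∀ y : EuclideanSpace ℝ (Fin m), ρ < ‖y‖ → ((s, y) : ℝ × _) ∉ tsupport θ := by
        intro y hy h
        have h1 := mem_closedBall_zero_iff.1 (hρ h)
        have h2 : ‖y‖ ≤ ‖((s, y) : ℝ × EuclideanSpace ℝ (Fin m))‖ :=
          norm_snd_le ((s, y) : ℝ × EuclideanSpace ℝ (Fin m))
        linarith
      have hθs_supp : HasCompactSupport fun y => θ (s, y) := by
        refine HasCompactSupport.intro (isCompact_closedBall (0 : EuclideanSpace ℝ (Fin m)) ρ)
          fun y hy => image_eq_zero_of_notMem_tsupport (hnot y ?_)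
        simpa using hy
      obtain ⟨D, hθs_lip⟩ := hθs_c1.lipschitzWith_of_hasCompactSupport hθs_supp one_ne_zero
      have ibp := LipschitzWith.integral_lineDeriv_mul_eq (μ := volume) hg_lip hθs_lip hθs_supp
        (EuclideanSpace.single α (1 : ℝ))
      -- `ibp : ∫ y, lineDeriv g y e * θ(s,y) = ∫ y, lineDeriv (θ(s,·)) y (-e) * g y`
      have hR : ∫ y, lineDeriv ℝ (fun y => θ (s, y)) y (-EuclideanSpace.single α (1 : ℝ)) * g y
          = -∫ x, lineDeriv ℝ θ (s, x) (dirX α) * F (s, x) := by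
        rw [← integral_neg]
        refine integral_congr_ae (Eventually.of_forall fun y => ?_)
        show lineDeriv ℝ (fun y => θ (s, y)) y (-EuclideanSpace.single α (1 : ℝ)) * g y
          = -(lineDeriv ℝ θ (s, y) (dirX α) * F (s, y))
        rw [lineDeriv_neg, lineDeriv_slice_space]
        show -lineDeriv ℝ θ (s, y) (dirX α) * g y = -(lineDeriv ℝ θ (s, y) (dirX α) * F (s, y))
        by_cases hy : y ∈ closedBall (0 : EuclideanSpace ℝ (Fin m)) R
        · rw [← hg_eq hy, neg_mul]
        · have : ((s, y) : ℝ × EuclideanSpace ℝ (Fin m)) ∉ tsupport θ := fun h =>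
            hy (mem_closedBall_zero_iff.2 (hθR (s, y) h).le)
          rw [lineDeriv_eq_zero_of_notMem_tsupport this]; ring
      have hL : ∫ y, lineDeriv ℝ g y (EuclideanSpace.single α (1 : ℝ)) * θ (s, y)
          = ∫ x, θ (s, x) * lineDeriv ℝ (fun y => F (s, y)) x (EuclideanSpace.single α (1 : ℝ)) := by
        refine integral_congr_ae (Eventually.of_forall fun y => ?_)
        show lineDeriv ℝ g y _ * θ (s, y) = θ (s, y) * lineDeriv ℝ (fun y => F (s, y)) y _
        by_cases hy : ‖y‖ < R
        · have : g =ᶠ[𝓝 y] fun y => F (s, y) := by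
            filter_upwards [isOpen_ball.mem_nhds (mem_ball_zero_iff.2 hy)] with z hz
            exact (hg_eq (ball_subset_closedBall hz)).symm
          rw [this.lineDeriv_eq, mul_comm]
        · have : ((s, y) : ℝ × EuclideanSpace ℝ (Fin m)) ∉ tsupport θ := fun h => hy (hθR (s, y) h)
          rw [image_eq_zero_of_notMem_tsupport this]; ring
      rw [hL, hR] at ibp
      rw [ibp, neg_neg]
  -- a.e. in `t`: the slice line derivative is the Fréchet derivative
  have e4 : ∀ᵐ s ∂((volume : Measure ℝ).restrict (Set.Ioo 0 T)),
      ∫ x, θ (s, x) * lineDeriv ℝ (fun y => F (s, y)) x (EuclideanSpace.single α (1 : ℝ))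
        = ∫ x, θ (s, x) * fderiv ℝ F (s, x) (dirX α) := by
    filter_upwards [ae_ae_space_of_ae_slab hFd] with s hs
    refine integral_congr_ae ?_
    filter_upwards [hs] with x hx
    rw [lineDeriv_slice_space, hx.lineDeriv_eq_fderiv]
    rfl
  -- assemble with Fubini (`t` outer)
  rw [integral_slab_eq_iterated hI1, integral_slab_eq_iterated hI2, ← integral_neg]
  refine integral_congr_ae ?_
  have hs_mem : ∀ᵐ s ∂((volume : Measure ℝ).restrict (Set.Ioo 0 T)), s ∈ Set.Ioo 0 T :=
    ae_restrict_mem measurableSet_Ioo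
  filter_upwards [e4, hs_mem] with s hs hs'
  rw [e3 s hs', hs]

end slabIBP

/-! ### Measurability of compositions with functions continuous on the state domain -/

section measurability

variable {X' : Type*} [MeasurableSpace X']

/-- A function continuous on `O` composed with a measurable `O`-valued field is measurable.
[folklore] -/
theorem measurable_comp_of_continuousOn {F' : Type*} [TopologicalSpace F'] [MeasurableSpace F']
    [BorelSpace F'] {O : Set (EuclideanSpace ℝ (Fin n))} {g : EuclideanSpace ℝ (Fin n) → F'}
    (hg : ContinuousOn g O) {V : X' → EuclideanSpace ℝ (Fin n)} (hVm : Measurable V)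
    (hVO : ∀ p, V p ∈ O) : Measurable fun p => g (V p) := by
  have : (fun p => g (V p)) = O.restrict g ∘ fun p => (⟨V p, hVO p⟩ : O) := rfl
  rw [this]
  exact hg.restrict.measurable.comp hVm.subtype_mk

/-- `p ↦ Dg(V p)·(w p)` is measurable for `g ∈ C¹(O)`, `V` measurable `O`-valued and `w`
measurable. [folklore] -/
theorem measurable_fderiv_comp_apply {F' : Type*} [NormedAddCommGroup F'] [NormedSpace ℝ F']
    [MeasurableSpace F'] [BorelSpace F'] [SecondCountableTopology F']
    {O : Set (EuclideanSpace ℝ (Fin n))} (hO : IsOpen O)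
    {g : EuclideanSpace ℝ (Fin n) → F'} (hg : ContDiffOn ℝ 1 g O)
    {V : X' → EuclideanSpace ℝ (Fin n)} (hVm : Measurable V) (hVO : ∀ p, V p ∈ O)
    {w : X' → EuclideanSpace ℝ (Fin n)} (hw : Measurable w) :
    Measurable fun p => fderiv ℝ g (V p) (w p) := by
  set Ψ : O × EuclideanSpace ℝ (Fin n) → F' := fun q => fderiv ℝ g q.1 q.2 with hΨ
  have hΨc : Continuous Ψ := by
    have h1 : Continuous (O.restrict (fderiv ℝ g)) :=
      (hg.continuousOn_fderiv_of_isOpen hO le_rfl).restrict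
    exact (h1.comp continuous_fst).clm_apply continuous_snd
  have : (fun p => fderiv ℝ g (V p) (w p)) = Ψ ∘ fun p => ((⟨V p, hVO p⟩ : O), w p) := rfl
  rw [this]
  exact hΨc.measurable.comp (hVm.subtype_mk.prodMk hw)

end measurability

/-! ### Rademacher on the slab -/

section rademacher

variable {V : ℝ × EuclideanSpace ℝ (Fin m) → EuclideanSpace ℝ (Fin n)} {T : ℝ}

/-- Every point of the slab lies in the interior of one of the boxes
`[0, T - 1/(k+1)] × B̄(0,k+1)`. [folklore] -/
theorem exists_box_mem_nhds {p : ℝ × EuclideanSpace ℝ (Fin m)} (hp : p ∈ slab m T) :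
    ∃ k : ℕ, Set.Ioo 0 (T - 1 / ((k : ℝ) + 1)) ×ˢ ball (0 : EuclideanSpace ℝ (Fin m)) ((k : ℝ) + 1)
      ∈ 𝓝 p := by
  have hp1 := (mem_slab.1 hp)
  obtain ⟨k, hk⟩ := exists_nat_gt (max (1 / (T - p.1)) ‖p.2‖)
  have hk1 : 1 / (T - p.1) < k := (le_max_left _ _).trans_lt hk
  have hk2 : ‖p.2‖ < k := (le_max_right _ _).trans_lt hk
  refine ⟨k, (isOpen_Ioo.prod isOpen_ball).mem_nhds ⟨⟨hp1.1, ?_⟩, mem_ball_zero_iff.2 (by linarith)⟩⟩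
  have hTp : 0 < T - p.1 := by linarith [hp1.2]
  have hk0 : (0 : ℝ) < (k : ℝ) + 1 := by positivity
  have : 1 / ((k : ℝ) + 1) < T - p.1 := by
    rw [div_lt_iff₀ hk0]
    have := (div_lt_iff₀ hTp).1 hk1
    nlinarith
  linarith

/-- **Rademacher on the slab**: a field Lipschitz on every box `[0,T'] × B̄(0,R)`, `T' < T`, is
Fréchet differentiable a.e. on the open slab. [folklore] -/
theorem ae_differentiableAt_of_lipschitzOn_boxes
    (hV : ∀ T' < T, ∀ R : ℝ, ∃ K : ℝ≥0,
      LipschitzOnWith K V (Set.Icc 0 T' ×ˢ closedBall (0 : EuclideanSpace ℝ (Fin m)) R)) :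
    ∀ᵐ p ∂(volume : Measure (ℝ × EuclideanSpace ℝ (Fin m))),
      p ∈ slab m T → DifferentiableAt ℝ V p := by
  haveI := isAddHaarMeasure_volume_spaceTime (m := m)
  have hk : ∀ k : ℕ, ∀ᵐ p ∂(volume : Measure (ℝ × EuclideanSpace ℝ (Fin m))),
      p ∈ Set.Icc 0 (T - 1 / ((k : ℝ) + 1)) ×ˢ closedBall (0 : EuclideanSpace ℝ (Fin m)) ((k : ℝ) + 1)
        → DifferentiableWithinAt ℝ V
          (Set.Icc 0 (T - 1 / ((k : ℝ) + 1)) ×ˢ closedBall (0 : EuclideanSpace ℝ (Fin m)) ((k : ℝ) + 1))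
          p := by
    intro k
    obtain ⟨K, hK⟩ := hV (T - 1 / ((k : ℝ) + 1)) (by
      have : (0 : ℝ) < 1 / ((k : ℝ) + 1) := by positivity
      linarith) ((k : ℝ) + 1)
    exact hK.ae_differentiableWithinAt_of_mem
  rw [← ae_all_iff] at hk
  filter_upwards [hk] with p hp hps
  obtain ⟨k, hk⟩ := exists_box_mem_nhds hps
  have hsub : Set.Ioo 0 (T - 1 / ((k : ℝ) + 1)) ×ˢ ball (0 : EuclideanSpace ℝ (Fin m)) ((k : ℝ) + 1)
      ⊆ Set.Icc 0 (T - 1 / ((k : ℝ) + 1)) ×ˢ closedBall (0 : EuclideanSpace ℝ (Fin m)) ((k : ℝ) + 1) :=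
    Set.prod_mono Set.Ioo_subset_Icc_self ball_subset_closedBall
  have hmem : Set.Icc 0 (T - 1 / ((k : ℝ) + 1)) ×ˢ closedBall (0 : EuclideanSpace ℝ (Fin m)) ((k : ℝ) + 1)
      ∈ 𝓝 p := mem_of_superset hk hsub
  exact (hp k (mem_of_mem_nhds hmem)).differentiableAt hmem

/-- On the slab, the Fréchet derivative of a field Lipschitz on the boxes is locally bounded: near
every point of the slab there is a neighbourhood on which `‖DV‖ ≤ K`. [folklore] -/
theorem exists_nhds_norm_fderiv_le
    (hV : ∀ T' < T, ∀ R : ℝ, ∃ K : ℝ≥0,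
      LipschitzOnWith K V (Set.Icc 0 T' ×ˢ closedBall (0 : EuclideanSpace ℝ (Fin m)) R))
    {p : ℝ × EuclideanSpace ℝ (Fin m)} (hp : p ∈ slab m T) :
    ∃ U ∈ 𝓝 p, IsOpen U ∧ Bornology.IsBounded U ∧ ∃ K : ℝ≥0, ∀ q ∈ U, ‖fderiv ℝ V q‖ ≤ K := by
  obtain ⟨k, hk⟩ := exists_box_mem_nhds hp
  obtain ⟨K, hK⟩ := hV (T - 1 / ((k : ℝ) + 1)) (by
    have : (0 : ℝ) < 1 / ((k : ℝ) + 1) := by positivity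
    linarith) ((k : ℝ) + 1)
  have hO : IsOpen (Set.Ioo 0 (T - 1 / ((k : ℝ) + 1)) ×ˢ ball (0 : EuclideanSpace ℝ (Fin m)) ((k : ℝ) + 1)) :=
    isOpen_Ioo.prod isOpen_ball
  refine ⟨_, hk, hO, ?_, K, fun q hq => ?_⟩
  · exact (Metric.isBounded_Ioo _ _).prod isBounded_ball
  · refine norm_fderiv_le_of_lipschitzOn ℝ ?_ hK
    exact mem_of_superset (hO.mem_nhds hq)
      (Set.prod_mono Set.Ioo_subset_Icc_self ball_subset_closedBall)

end rademacher

/-! ### The system holds a.e. for a Lipschitz weak solution -/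

section pde

variable {O D : Set (EuclideanSpace ℝ (Fin n))}
  {G : Fin m → EuclideanSpace ℝ (Fin n) → EuclideanSpace ℝ (Fin n)} {T : ℝ}
  {V : ℝ × EuclideanSpace ℝ (Fin m) → EuclideanSpace ℝ (Fin n)}

/-- A `C¹` map on an open set containing a compact convex `D` is Lipschitz on `D`. [folklore] -/
theorem exists_lipschitzOnWith_of_contDiffOn {F' : Type*} [NormedAddCommGroup F']
    [NormedSpace ℝ F'] {g : EuclideanSpace ℝ (Fin n) → F'}
    (hO : IsOpen O) (hg : ContDiffOn ℝ 1 g O) (hD : D ⊆ O) (hDc : IsCompact D) (hDconv : Convex ℝ D) :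
    ∃ L : ℝ≥0, LipschitzOnWith L g D := by
  obtain ⟨C, hC⟩ := hDc.exists_bound_of_continuousOn
    ((hg.continuousOn_fderiv_of_isOpen hO le_rfl).mono hD)
  refine ⟨C.toNNReal, hDconv.lipschitzOnWith_of_nnnorm_fderiv_le (𝕜 := ℝ) (fun x hx => ?_) fun x hx => ?_⟩
  · exact ((hg.contDiffAt (hO.mem_nhds (hD hx))).differentiableAt one_ne_zero)
  · rw [← norm_toNNReal]; exact Real.toNNReal_le_toNNReal (hC x hx)

/-- Test functions compactly supported in the open slab vanish for `t ≥ T'` for some `T' ∈ (0,T)`,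
vanish at `t = 0`, and are supported in `|x| < R` for some `R`. [folklore] -/
theorem exists_margins_of_tsupport_subset_slab (hT : 0 < T) {φ : ℝ × EuclideanSpace ℝ (Fin m) → ℝ}
    (hφc : HasCompactSupport φ) (hφs : tsupport φ ⊆ slab m T) :
    ∃ T' R : ℝ, 0 < T' ∧ T' < T ∧ (∀ p : ℝ × EuclideanSpace ℝ (Fin m), T' ≤ p.1 → φ p = 0) ∧
      (∀ p ∈ tsupport φ, ‖p.2‖ < R) ∧ (∀ x, φ (0, x) = 0) := by
  obtain ⟨R₀, hR₀⟩ := hφc.isCompact.isBounded.subset_closedBall 0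
  obtain ⟨δ, hδ0, hδ⟩ := hφc.isCompact.exists_cthickening_subset_open (isOpen_slab T) hφs
  set ε : ℝ := min δ (T / 2) with hε
  have hε0 : 0 < ε := lt_min hδ0 (by linarith)
  refine ⟨T - ε, R₀ + 1, by linarith [min_le_right δ (T / 2)], by linarith, fun p hp => ?_,
    fun p hp => ?_, fun x => ?_⟩
  · by_contra hne
    have hp' : p ∈ tsupport φ := subset_tsupport _ hne
    have hq : ((p.1 + ε, p.2) : ℝ × EuclideanSpace ℝ (Fin m)) ∈ cthickening δ (tsupport φ) := by
      refine mem_cthickening_of_dist_le _ p _ _ hp' ?_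
      rw [Prod.dist_eq, dist_self, Real.dist_eq]
      simp only [add_sub_cancel_left, abs_of_pos hε0]
      exact max_le (min_le_left _ _) hδ0.le
    have := (mem_slab.1 (hδ hq)).2
    simp only at this
    linarith
  · have := mem_closedBall_zero_iff.1 (hR₀ hp)
    linarith [norm_snd_le p]
  · apply image_eq_zero_of_notMem_tsupport
    intro h
    exact (lt_irrefl (0 : ℝ)) (mem_slab.1 (hφs h)).1

/-- **A locally Lipschitz weak solution satisfies the system almost everywhere** (Dafermos 2000,
§4.1 p. 110: "Any weak solution which is locally Lipschitz is necessarily a classical solution").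
Here `V : ℝ × ℝ^m → ℝⁿ` is measurable with values in a compact convex `D ⊆ O`, Lipschitz on every
box `[0,T'] × B̄(0,R)` (`T' < T`), and satisfies the weak identity (4.1.6) in slab form for smooth
test functions supported in the open slab; then `DV·e₀ + ∑_α DG_α(V) DV·(0,e_α) = 0` a.e. on the
slab (integration by parts `slab_ibp_time/space` and the fundamental lemma of the calculus of
variations `IsOpen.ae_eq_zero_of_integral_contDiff_smul_eq_zero`).
[cite: Dafermos2000, §4.1 p. 110] -/
theorem ae_pde_of_lipschitz_weak (hO : IsOpen O) (hG : ∀ α, ContDiffOn ℝ 1 (G α) O)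
    (hD : D ⊆ O) (hDc : IsCompact D) (hDconv : Convex ℝ D) (hT : 0 < T)
    (hVm : Measurable V) (hVD : ∀ p, V p ∈ D)
    (hVlip : ∀ T' < T, ∀ R : ℝ, ∃ K : ℝ≥0,
      LipschitzOnWith K V (Set.Icc 0 T' ×ˢ closedBall (0 : EuclideanSpace ℝ (Fin m)) R))
    (hVweak : ∀ φ : ℝ × EuclideanSpace ℝ (Fin m) → ℝ, ContDiff ℝ ∞ φ → HasCompactSupport φ →
      tsupport φ ⊆ slab m T →
      ∫ p in slab m T, (lineDeriv ℝ φ p (dirT m) • V p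
        + ∑ α : Fin m, lineDeriv ℝ φ p (dirX α) • G α (V p)) = 0) :
    ∀ᵐ p ∂(volume : Measure (ℝ × EuclideanSpace ℝ (Fin m))), p ∈ slab m T →
      fderiv ℝ V p (dirT m) + ∑ α : Fin m, fderiv ℝ (G α) (V p) (fderiv ℝ V p (dirX α)) = 0 := by
  haveI := isAddHaarMeasure_volume_spaceTime (m := m)
  have hVO : ∀ p, V p ∈ O := fun p => hD (hVD p)
  -- bounds on `D`
  obtain ⟨MV, hMV⟩ : ∃ M, ∀ v ∈ D, ‖v‖ ≤ M := hDc.exists_bound_of_continuousOn continuousOn_id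
  have hGM : ∀ α, ∃ M, ∀ v ∈ D, ‖G α v‖ ≤ M := fun α =>
    hDc.exists_bound_of_continuousOn ((hG α).continuousOn.mono hD)
  have hGd : ∀ α, ∀ v ∈ D, DifferentiableAt ℝ (G α) v := fun α v hv =>
    ((hG α).contDiffAt (hO.mem_nhds (hD hv))).differentiableAt one_ne_zero
  have hGfb : ∀ α, ∃ C, ∀ v ∈ D, ‖fderiv ℝ (G α) v‖ ≤ C := fun α =>
    hDc.exists_bound_of_continuousOn (((hG α).continuousOn_fderiv_of_isOpen hO le_rfl).mono hD)
  have hGlip : ∀ α, ∃ L : ℝ≥0, LipschitzOnWith L (G α) D := fun α =>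
    exists_lipschitzOnWith_of_contDiffOn hO (hG α) hD hDc hDconv
  -- a.e. differentiability (Rademacher)
  have hVd := ae_differentiableAt_of_lipschitzOn_boxes hVlip
  -- the residual and its measurability / local integrability
  set r : ℝ × EuclideanSpace ℝ (Fin m) → EuclideanSpace ℝ (Fin n) := fun p =>
    fderiv ℝ V p (dirT m) + ∑ α : Fin m, fderiv ℝ (G α) (V p) (fderiv ℝ V p (dirX α)) with hr
  have hr_meas : Measurable r := by
    refine (measurable_fderiv_apply_const ℝ V (dirT m)).add
      (Finset.measurable_fun_sum _ fun α _ => ?_)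
    exact measurable_fderiv_comp_apply hO (hG α) hVm hVO (measurable_fderiv_apply_const ℝ V (dirX α))
  choose C hC using hGfb
  have hr_loc : LocallyIntegrableOn r (slab m T) volume := by
    intro p hp
    obtain ⟨U, hU, hUo, hUb, K, hK⟩ := exists_nhds_norm_fderiv_le hVlip hp
    refine ⟨U, mem_nhdsWithin_of_mem_nhds hU, ?_⟩
    refine Measure.integrableOn_of_bounded (M := K * ‖dirT m‖ + ∑ α : Fin m, C α * (K * ‖dirX α‖))
      hUb.measure_lt_top.ne hr_meas.aestronglyMeasurable ?_
    rw [ae_restrict_iff' hUo.measurableSet]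
    refine Eventually.of_forall fun q hq => ?_
    have hb1 : ∀ v, ‖fderiv ℝ V q v‖ ≤ K * ‖v‖ := fun v =>
      (ContinuousLinearMap.le_opNorm _ _).trans (mul_le_mul_of_nonneg_right (hK q hq) (norm_nonneg _))
    calc ‖r q‖ ≤ ‖fderiv ℝ V q (dirT m)‖
          + ∑ α : Fin m, ‖fderiv ℝ (G α) (V q) (fderiv ℝ V q (dirX α))‖ :=
          norm_add_le_of_le le_rfl (norm_sum_le _ _)
      _ ≤ K * ‖dirT m‖ + ∑ α : Fin m, C α * (K * ‖dirX α‖) := by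
          refine add_le_add (hb1 _) (Finset.sum_le_sum fun α _ => ?_)
          calc ‖fderiv ℝ (G α) (V q) (fderiv ℝ V q (dirX α))‖
              ≤ ‖fderiv ℝ (G α) (V q)‖ * ‖fderiv ℝ V q (dirX α)‖ := ContinuousLinearMap.le_opNorm _ _
            _ ≤ C α * (K * ‖dirX α‖) :=
                mul_le_mul (hC α _ (hVD q)) (hb1 _) (norm_nonneg _)
                  ((norm_nonneg _).trans (hC α _ (hVD q)))
  -- the fundamental lemma of the calculus of variations
  refine (isOpen_slab T).ae_eq_zero_of_integral_contDiff_smul_eq_zero hr_loc fun φ hφ hφc hφs => ?_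
  obtain ⟨T', R, hT'0, hT'T, hφT, hφR, hφ0⟩ := exists_margins_of_tsupport_subset_slab hT hφc hφs
  have hφ1 : ContDiff ℝ 1 φ := hφ.of_le (mod_cast le_top)
  obtain ⟨K, hK⟩ := hVlip T' hT'T R
  -- integrability of `φ • r` on the slab and reduction to the slab
  have hφr : IntegrableOn (fun p => φ p • r p) (slab m T) := by
    have h1 : IntegrableOn r (tsupport φ) := hr_loc.integrableOn_compact_subset hφs hφc
    have h2 : IntegrableOn (fun p => φ p • r p) (tsupport φ) :=
      h1.continuousOn_smul hφ.continuous.continuousOn hφc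
    exact h2.of_forall_sdiff_eq_zero (measurableSet_slab T) fun p hp => by
      rw [image_eq_zero_of_notMem_tsupport hp.2, zero_smul]
  rw [← setIntegral_eq_integral_of_forall_compl_eq_zero (s := slab m T) (fun p hp => by
    rw [image_eq_zero_of_notMem_tsupport (fun h => hp (hφs h)), zero_smul])]
  -- the weak identity, tested with `φ`, in coordinates
  have hw := hVweak φ hφ hφc hφs
  have hφt_cont : ∀ v, Continuous fun p => lineDeriv ℝ φ p v := continuous_lineDeriv_of_contDiff hφ1
  have hφt_supp : ∀ v, HasCompactSupport fun p => lineDeriv ℝ φ p v :=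
    hasCompactSupport_lineDeriv_of_contDiff hφ1 hφc
  have hVam : AEStronglyMeasurable V (volume.restrict (slab m T)) := hVm.aestronglyMeasurable
  have hGVm : ∀ α, Measurable fun p => G α (V p) := fun α =>
    measurable_comp_of_continuousOn (hG α).continuousOn hVm hVO
  obtain ⟨MG, hMG⟩ : ∃ M, ∀ α, ∀ v ∈ D, ‖G α v‖ ≤ M := by
    choose M hM using hGM
    refine ⟨∑ α, max (M α) 0, fun α v hv => (hM α v hv).trans ?_⟩
    exact (le_max_left _ _).trans
      (Finset.single_le_sum (f := fun α => max (M α) 0) (fun i _ => le_max_right _ _)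
        (Finset.mem_univ α))
  have hIw1 : IntegrableOn (fun p => lineDeriv ℝ φ p (dirT m) • V p) (slab m T) :=
    integrableOn_slab_smul (hφt_cont _) (hφt_supp _) hVam fun p _ => hMV _ (hVD p)
  have hIw2 : ∀ α, IntegrableOn (fun p => lineDeriv ℝ φ p (dirX α) • G α (V p)) (slab m T) :=
    fun α => integrableOn_slab_smul (hφt_cont _) (hφt_supp _) (hGVm α).aestronglyMeasurable
      fun p _ => hMG α _ (hVD p)
  have hIw : IntegrableOn (fun p => lineDeriv ℝ φ p (dirT m) • V p
      + ∑ α : Fin m, lineDeriv ℝ φ p (dirX α) • G α (V p)) (slab m T) :=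
    hIw1.add (integrable_finsetSum _ fun α _ => hIw2 α)
  -- work coordinatewise
  suffices key : ∀ i : Fin n, (∫ p in slab m T, φ p • r p) i = 0 by
    ext i; simpa only [PiLp.zero_apply] using key i
  intro i
  set Li : EuclideanSpace ℝ (Fin n) →L[ℝ] ℝ := EuclideanSpace.proj i with hLi
  have hLi_apply : ∀ v : EuclideanSpace ℝ (Fin n), Li v = v i := fun v => rfl
  -- scalar components
  set Vi : ℝ × EuclideanSpace ℝ (Fin m) → ℝ := fun p => V p i with hVi
  set GVi : Fin m → ℝ × EuclideanSpace ℝ (Fin m) → ℝ := fun α p => G α (V p) i with hGVi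
  have mVi : Measurable Vi := Li.measurable.comp hVm
  have mGVi : ∀ α, Measurable (GVi α) := fun α => Li.measurable.comp (hGVm α)
  have lipVi : LipschitzOnWith (‖Li‖₊ * K) Vi (Set.Icc 0 T' ×ˢ closedBall 0 R) :=
    Li.lipschitz.comp_lipschitzOnWith hK
  have lipGVi : ∀ α, ∃ K' : ℝ≥0, LipschitzOnWith K' (GVi α) (Set.Icc 0 T' ×ˢ closedBall 0 R) := by
    intro α
    obtain ⟨L, hL⟩ := hGlip α
    exact ⟨‖Li‖₊ * (L * K), Li.lipschitz.comp_lipschitzOnWith (hL.comp hK fun p _ => hVD p)⟩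
  have dVi : ∀ᵐ p ∂volume, p ∈ slab m T → DifferentiableAt ℝ Vi p := by
    filter_upwards [hVd] with p hp hps
    exact Li.differentiableAt.comp p (hp hps)
  have dGVi : ∀ α, ∀ᵐ p ∂volume, p ∈ slab m T → DifferentiableAt ℝ (GVi α) p := by
    intro α
    filter_upwards [hVd] with p hp hps
    exact Li.differentiableAt.comp p ((hGd α _ (hVD p)).comp p (hp hps))
  -- values of the derivatives at points of differentiability of `V`
  have eVi : ∀ p, DifferentiableAt ℝ V p → ∀ v, fderiv ℝ Vi p v = (fderiv ℝ V p v) i := by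
    intro p hp v
    have : HasFDerivAt Vi (Li.comp (fderiv ℝ V p)) p := Li.hasFDerivAt.comp p hp.hasFDerivAt
    rw [this.fderiv]; rfl
  have eGVi : ∀ α p, DifferentiableAt ℝ V p → ∀ v,
      fderiv ℝ (GVi α) p v = (fderiv ℝ (G α) (V p) (fderiv ℝ V p v)) i := by
    intro α p hp v
    have : HasFDerivAt (GVi α) (Li.comp ((fderiv ℝ (G α) (V p)).comp (fderiv ℝ V p))) p :=
      Li.hasFDerivAt.comp p ((hGd α _ (hVD p)).hasFDerivAt.comp p hp.hasFDerivAt)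
    rw [this.fderiv]; rfl
  -- integration by parts for the components
  have ibpT := slab_ibp_time hT'0 hT'T hφ1 hφc hφT hφR mVi.aestronglyMeasurable
    (mVi.comp (measurable_const.prodMk measurable_id)).aestronglyMeasurable lipVi dVi
  have ibpX : ∀ α, ∫ p in slab m T, lineDeriv ℝ φ p (dirX α) * GVi α p
      = -∫ p in slab m T, φ p * fderiv ℝ (GVi α) p (dirX α) := by
    intro α
    obtain ⟨K', hK'⟩ := lipGVi α
    exact slab_ibp_space hφ1 hφc hφT hφR (mGVi α).aestronglyMeasurable hK' (dGVi α) α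
  have hbdry : ∫ x, φ (0, x) * Vi (0, x) = 0 := by simp [hφ0]
  rw [hbdry, neg_zero, zero_sub] at ibpT
  -- the weak identity in the `i`-th coordinate
  have hwi : (∫ p in slab m T, lineDeriv ℝ φ p (dirT m) * Vi p)
      + ∑ α : Fin m, ∫ p in slab m T, lineDeriv ℝ φ p (dirX α) * GVi α p = 0 := by
    have h1 := congrArg Li hw
    rw [map_zero, ← Li.integral_comp_comm hIw] at h1
    have h2 : ∀ p, Li (lineDeriv ℝ φ p (dirT m) • V p
        + ∑ α : Fin m, lineDeriv ℝ φ p (dirX α) • G α (V p))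
        = lineDeriv ℝ φ p (dirT m) * Vi p + ∑ α : Fin m, lineDeriv ℝ φ p (dirX α) * GVi α p := by
      intro p
      rw [hLi_apply]
      simp [hVi, hGVi]
    simp_rw [h2] at h1
    have hI1 : IntegrableOn (fun p => lineDeriv ℝ φ p (dirT m) * Vi p) (slab m T) :=
      integrableOn_slab_lineDeriv_mul hφ1 hφc hφT hφR mVi.aestronglyMeasurable lipVi _
    have hI2 : ∀ α, IntegrableOn (fun p => lineDeriv ℝ φ p (dirX α) * GVi α p) (slab m T) := by
      intro α
      obtain ⟨K', hK'⟩ := lipGVi α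
      exact integrableOn_slab_lineDeriv_mul hφ1 hφc hφT hφR (mGVi α).aestronglyMeasurable hK' _
    rw [integral_add hI1 (integrable_finsetSum _ fun α _ => hI2 α),
      integral_finsetSum _ fun α _ => hI2 α] at h1
    exact h1
  rw [ibpT] at hwi
  simp_rw [ibpX] at hwi
  -- `hwi : -∫ φ DVi·e₀ + ∑ α, -∫ φ D(GVi α)·e_α = 0`
  have hJ1 : IntegrableOn (fun p => φ p * fderiv ℝ Vi p (dirT m)) (slab m T) :=
    integrableOn_slab_mul_fderiv hφ1 hφc hφT hφR lipVi _
  have hJ2 : ∀ α, IntegrableOn (fun p => φ p * fderiv ℝ (GVi α) p (dirX α)) (slab m T) := by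
    intro α
    obtain ⟨K', hK'⟩ := lipGVi α
    exact integrableOn_slab_mul_fderiv hφ1 hφc hφT hφR hK' _
  have hsum : ∫ p in slab m T, φ p * (fderiv ℝ Vi p (dirT m)
      + ∑ α : Fin m, fderiv ℝ (GVi α) p (dirX α)) = 0 := by
    have : ∫ p in slab m T, φ p * (fderiv ℝ Vi p (dirT m)
        + ∑ α : Fin m, fderiv ℝ (GVi α) p (dirX α))
        = (∫ p in slab m T, φ p * fderiv ℝ Vi p (dirT m))
          + ∑ α : Fin m, ∫ p in slab m T, φ p * fderiv ℝ (GVi α) p (dirX α) := by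
      rw [← integral_finsetSum _ fun α _ => hJ2 α, ← integral_add hJ1
        (integrable_finsetSum _ fun α _ => hJ2 α)]
      refine integral_congr_ae (Eventually.of_forall fun p => ?_)
      simp only [mul_add, Finset.mul_sum]
    rw [this]
    simp only [Finset.sum_neg_distrib] at hwi
    linarith
  -- identify the integrand a.e. with `φ · (r ·) i`
  rw [show (∫ p in slab m T, φ p • r p) i = Li (∫ p in slab m T, φ p • r p) from rfl,
    ← Li.integral_comp_comm hφr]
  simp only [map_smul, smul_eq_mul]
  rw [← hsum]
  refine setIntegral_congr_ae (measurableSet_slab T) ?_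
  filter_upwards [hVd] with p hp hps
  rw [hLi_apply, eVi p (hp hps)]
  simp only [hr, eGVi _ p (hp hps)]
  congr 1
  simp


end pde

/-! ### The entropy equality for a classical solution -/

section entropyEq

variable {O D : Set (EuclideanSpace ℝ (Fin n))}
  {G : Fin m → EuclideanSpace ℝ (Fin n) → EuclideanSpace ℝ (Fin n)}
  {η : EuclideanSpace ℝ (Fin n) → ℝ} {q : Fin m → EuclideanSpace ℝ (Fin n) → ℝ} {T : ℝ}
  {V : ℝ × EuclideanSpace ℝ (Fin m) → EuclideanSpace ℝ (Fin n)}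

/-- **A classical solution satisfies the entropy inequality (4.3.4) as an equality** (Dafermos
2000, proof of Thm 5.2.1, p. 127: "`Ū`, being a classical solution, will identically satisfy
(4.3.4) as an equality"; §4.3 p. 113: "all classical solutions ... do satisfy (4.3.3), (4.3.5), and a
fortiori (4.3.4), as equalities").  For `V` measurable with values in a compact convex `D ⊆ O`,
Lipschitz on the boxes `[0,T'] × B̄(0,R)` and satisfying the system a.e. on the slab, and an
entropy–entropy-flux pair with `Dq_α = Dη DG_α` on `O` (4.3.1): for every `θ ∈ C¹_c` vanishing
for `t ≥ T' < T`,
`∫_slab [∂ₜθ η(V) + ∑_α ∂_αθ q_α(V)] = -∫ θ(0,x) η(V(0,x)) dx`.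
[cite: Dafermos2000, §4.3 p. 113 & Thm 5.2.1 proof p. 127] -/
theorem entropy_equality_of_lipschitz (hO : IsOpen O)
    (hη : ContDiffOn ℝ 1 η O) (hq : ∀ α, ContDiffOn ℝ 1 (q α) O)
    (hcompat : ∀ v ∈ O, ∀ α, fderiv ℝ (q α) v = (fderiv ℝ η v).comp (fderiv ℝ (G α) v))
    (hD : D ⊆ O) (hDc : IsCompact D) (hDconv : Convex ℝ D) (hT : 0 < T)
    (hVm : Measurable V) (hVD : ∀ p, V p ∈ D)
    (hVlip : ∀ T' < T, ∀ R : ℝ, ∃ K : ℝ≥0,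
      LipschitzOnWith K V (Set.Icc 0 T' ×ˢ closedBall (0 : EuclideanSpace ℝ (Fin m)) R))
    (hpde : ∀ᵐ p ∂(volume : Measure (ℝ × EuclideanSpace ℝ (Fin m))), p ∈ slab m T →
      fderiv ℝ V p (dirT m) + ∑ α : Fin m, fderiv ℝ (G α) (V p) (fderiv ℝ V p (dirX α)) = 0)
    {θ : ℝ × EuclideanSpace ℝ (Fin m) → ℝ} (hθ : ContDiff ℝ 1 θ) (hθc : HasCompactSupport θ)
    {T' : ℝ} (hT'T : T' < T) (hθT : ∀ p : ℝ × EuclideanSpace ℝ (Fin m), T' ≤ p.1 → θ p = 0) :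
    ∫ p in slab m T, (lineDeriv ℝ θ p (dirT m) * η (V p)
        + ∑ α : Fin m, lineDeriv ℝ θ p (dirX α) * q α (V p))
      = -∫ x, θ (0, x) * η (V (0, x)) := by
  haveI := isAddHaarMeasure_volume_spaceTime (m := m)
  have hVO : ∀ p, V p ∈ O := fun p => hD (hVD p)
  -- margins
  set T'' : ℝ := max T' (T / 2) with hT''
  have hT''0 : 0 < T'' := lt_of_lt_of_le (by linarith) (le_max_right _ _)
  have hT''T : T'' < T := max_lt hT'T (by linarith)
  have hθT'' : ∀ p : ℝ × EuclideanSpace ℝ (Fin m), T'' ≤ p.1 → θ p = 0 := fun p hp =>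
    hθT p ((le_max_left _ _).trans hp)
  obtain ⟨R₀, hR₀⟩ := hθc.isCompact.isBounded.subset_closedBall 0
  have hθR : ∀ p ∈ tsupport θ, ‖p.2‖ < R₀ + 1 := fun p hp => by
    have := mem_closedBall_zero_iff.1 (hR₀ hp)
    linarith [norm_snd_le p]
  obtain ⟨K, hK⟩ := hVlip T'' hT''T (R₀ + 1)
  -- Lipschitz / differentiability data of `η`, `q α` on `D`
  obtain ⟨Lη, hLη⟩ := exists_lipschitzOnWith_of_contDiffOn hO hη hD hDc hDconv
  have hLq : ∀ α, ∃ L : ℝ≥0, LipschitzOnWith L (q α) D := fun α =>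
    exists_lipschitzOnWith_of_contDiffOn hO (hq α) hD hDc hDconv
  have hηd : ∀ v ∈ D, DifferentiableAt ℝ η v := fun v hv =>
    (hη.contDiffAt (hO.mem_nhds (hD hv))).differentiableAt one_ne_zero
  have hqd : ∀ α, ∀ v ∈ D, DifferentiableAt ℝ (q α) v := fun α v hv =>
    ((hq α).contDiffAt (hO.mem_nhds (hD hv))).differentiableAt one_ne_zero
  have hVd := ae_differentiableAt_of_lipschitzOn_boxes hVlip
  -- the composites
  set Fη : ℝ × EuclideanSpace ℝ (Fin m) → ℝ := fun p => η (V p) with hFη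
  set Fq : Fin m → ℝ × EuclideanSpace ℝ (Fin m) → ℝ := fun α p => q α (V p) with hFq
  have mFη : Measurable Fη := measurable_comp_of_continuousOn hη.continuousOn hVm hVO
  have mFq : ∀ α, Measurable (Fq α) := fun α =>
    measurable_comp_of_continuousOn (hq α).continuousOn hVm hVO
  have lipFη : LipschitzOnWith (Lη * K) Fη (Set.Icc 0 T'' ×ˢ closedBall 0 (R₀ + 1)) :=
    hLη.comp hK fun p _ => hVD p
  have lipFq : ∀ α, ∃ K' : ℝ≥0, LipschitzOnWith K' (Fq α) (Set.Icc 0 T'' ×ˢ closedBall 0 (R₀ + 1)) := by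
    intro α
    obtain ⟨L, hL⟩ := hLq α
    exact ⟨L * K, hL.comp hK fun p _ => hVD p⟩
  have dFη : ∀ᵐ p ∂volume, p ∈ slab m T → DifferentiableAt ℝ Fη p := by
    filter_upwards [hVd] with p hp hps
    exact (hηd _ (hVD p)).comp p (hp hps)
  have dFq : ∀ α, ∀ᵐ p ∂volume, p ∈ slab m T → DifferentiableAt ℝ (Fq α) p := by
    intro α
    filter_upwards [hVd] with p hp hps
    exact (hqd α _ (hVD p)).comp p (hp hps)
  have eFη : ∀ p, DifferentiableAt ℝ V p → ∀ v,
      fderiv ℝ Fη p v = fderiv ℝ η (V p) (fderiv ℝ V p v) := by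
    intro p hp v
    rw [show Fη = η ∘ V from rfl, fderiv_comp p (hηd _ (hVD p)) hp]; rfl
  have eFq : ∀ α p, DifferentiableAt ℝ V p → ∀ v,
      fderiv ℝ (Fq α) p v = fderiv ℝ η (V p) (fderiv ℝ (G α) (V p) (fderiv ℝ V p v)) := by
    intro α p hp v
    rw [show Fq α = q α ∘ V from rfl, fderiv_comp p (hqd α _ (hVD p)) hp,
      hcompat _ (hVO p) α]; rfl
  -- integration by parts
  have ibpT := slab_ibp_time hT''0 hT''T hθ hθc hθT'' hθR mFη.aestronglyMeasurable
    (mFη.comp (measurable_const.prodMk measurable_id)).aestronglyMeasurable lipFη dFη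
  have ibpX : ∀ α, ∫ p in slab m T, lineDeriv ℝ θ p (dirX α) * Fq α p
      = -∫ p in slab m T, θ p * fderiv ℝ (Fq α) p (dirX α) := by
    intro α
    obtain ⟨K', hK'⟩ := lipFq α
    exact slab_ibp_space hθ hθc hθT'' hθR (mFq α).aestronglyMeasurable hK' (dFq α) α
  -- integrability
  have hI1 : IntegrableOn (fun p => lineDeriv ℝ θ p (dirT m) * Fη p) (slab m T) :=
    integrableOn_slab_lineDeriv_mul hθ hθc hθT'' hθR mFη.aestronglyMeasurable lipFη _
  have hI2 : ∀ α, IntegrableOn (fun p => lineDeriv ℝ θ p (dirX α) * Fq α p) (slab m T) := by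
    intro α
    obtain ⟨K', hK'⟩ := lipFq α
    exact integrableOn_slab_lineDeriv_mul hθ hθc hθT'' hθR (mFq α).aestronglyMeasurable hK' _
  have hJ1 : IntegrableOn (fun p => θ p * fderiv ℝ Fη p (dirT m)) (slab m T) :=
    integrableOn_slab_mul_fderiv hθ hθc hθT'' hθR lipFη _
  have hJ2 : ∀ α, IntegrableOn (fun p => θ p * fderiv ℝ (Fq α) p (dirX α)) (slab m T) := by
    intro α
    obtain ⟨K', hK'⟩ := lipFq α
    exact integrableOn_slab_mul_fderiv hθ hθc hθT'' hθR hK' _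
  -- the derivative terms cancel a.e. by the system and the compatibility condition
  have hcancel : (∫ p in slab m T, θ p * fderiv ℝ Fη p (dirT m))
      + ∑ α : Fin m, ∫ p in slab m T, θ p * fderiv ℝ (Fq α) p (dirX α) = 0 := by
    rw [← integral_finsetSum _ fun α _ => hJ2 α,
      ← integral_add hJ1 (integrable_finsetSum _ fun α _ => hJ2 α)]
    refine (setIntegral_congr_ae (measurableSet_slab T) ?_).trans
      (integral_zero (ℝ × EuclideanSpace ℝ (Fin m)) ℝ)
    filter_upwards [hVd, hpde] with p hp hp' hps
    have e1 : fderiv ℝ Fη p (dirT m) + ∑ α : Fin m, fderiv ℝ (Fq α) p (dirX α)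
        = fderiv ℝ η (V p) (fderiv ℝ V p (dirT m)
          + ∑ α : Fin m, fderiv ℝ (G α) (V p) (fderiv ℝ V p (dirX α))) := by
      rw [map_add, map_sum, eFη p (hp hps)]
      congr 1
      exact Finset.sum_congr rfl fun α _ => eFq α p (hp hps) _
    calc θ p * fderiv ℝ Fη p (dirT m) + ∑ α : Fin m, θ p * fderiv ℝ (Fq α) p (dirX α)
        = θ p * (fderiv ℝ Fη p (dirT m) + ∑ α : Fin m, fderiv ℝ (Fq α) p (dirX α)) := by
          rw [mul_add, Finset.mul_sum]
      _ = 0 := by rw [e1, hp' hps, map_zero, mul_zero]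
  -- assemble
  calc ∫ p in slab m T, (lineDeriv ℝ θ p (dirT m) * η (V p)
          + ∑ α : Fin m, lineDeriv ℝ θ p (dirX α) * q α (V p))
      = (∫ p in slab m T, lineDeriv ℝ θ p (dirT m) * Fη p)
          + ∑ α : Fin m, ∫ p in slab m T, lineDeriv ℝ θ p (dirX α) * Fq α p := by
        rw [integral_add hI1 (integrable_finsetSum _ fun α _ => hI2 α),
          integral_finsetSum _ fun α _ => hI2 α]
    _ = (-(∫ x, θ (0, x) * Fη (0, x)) - ∫ p in slab m T, θ p * fderiv ℝ Fη p (dirT m))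
          + ∑ α : Fin m, -∫ p in slab m T, θ p * fderiv ℝ (Fq α) p (dirX α) := by
        rw [ibpT]
        exact congrArg _ (Finset.sum_congr rfl fun α _ => ibpX α)
    _ = -∫ x, θ (0, x) * η (V (0, x)) := by
        rw [Finset.sum_neg_distrib]
        linarith [hcancel]

end entropyEq

end ConservationLaw

end Literature.Analysis.PDE
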